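import Summits.QuantumFields.YangMills.Theorems.UnitScaleTiltProp7SU2NonCommutingPairs
import Summits.QuantumFields.YangMills.Theorems.BalabanUVNodesN12FlatFibreNullSpace
import Literature.MathematicalPhysics.QuantumFieldTheory.Balaban1983to89.T3ContinuumYM3Torus
import HarnessLib

/-!
# Route `UnitScaleTilt`, crux K1 child «MinimiserStabilityRegPr» (stmt-QuantumFields-19200), skeleton v10, stub `stub_existenceMinimalOrbit` (EX),
# DENSITY line (★★OWNER RULING g28-№8 (B)) — **(D3) IRREDUCIBLE COARSE FIELDS ARE DENSE: every `SU(2)` lattice gauge field on a torus `T^{(j)}` with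
# `d ≥ 3` is a limit of fields whose parallel `M₂(ℂ)`-sections are all scalar** (two plaquette holonomies through one site are made non-commuting by
# multiplying two bond variables by `r₁(s), r₂(s) → 1`; a parallel section commutes with every plaquette holonomy at its base site, so its value there is
# scalar, and a parallel section which is scalar at one site is that scalar everywhere)

Cell `ym3-torus`, width seat `ym3-torus-px10` (gen 3).  THEOREMS ONLY (0 `def`, 0 `sorry`).  `--supports stmt-QuantumFields-19200 --as helper`,
count-neutral.  YM₃ on T³ is a ladder rung (R3), not the Clay problem; nothing here claims the stub, the crux, d = 4 or the mass gap.

WHY.  Input (DENSE) of ✓-candidate `Prop7ExistenceByDensityLimit.existenceMinimalOrbit_of_macroSector_dense_localSurj` with the sector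
`Sec F n V := «every V-parallel M₂(ℂ)-section is scalar»` — the sector on which the lift row `hLift` of the S7′ chain holds at EVERY regular centre
(✓p671081 `Prop7NestedMeanParallelLift.hLift_of_onlyScalarParallel`), so that EX at irreducible data needs no symmetric centre.

WHAT IS PROVED (sorry-free, no definition; ns `…Theorems.Prop7IrreducibleCoarseFieldsDense`; any `Params P`, any level `j`):
* §1 `mul_plaqHol_eq_of_parallel` — a `V`-parallel section (`cf(b₋)·V(b) = V(b)·cf(b₊)` on every bond) commutes with every plaquette holonomy at the
  plaquette's base site; `parallel_shift_iff` — `cf(x + e_μ) = z·1 ↔ cf(x) = z·1`; ★`forall_eq_smul_one_of_parallel` — if two plaquette holonomies based at one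
  site do not commute, every parallel section is a scalar constant (✓`Prop7SU2NonCommutingPairs.exists_eq_smul_one_of_commute_of_not_commute` at the site,
  ✓`N12FlatFibreNullSpace.const_of_shift_eq` on the indicator of `{cf = z·1}`).
* §2 the two-bond perturbation `V_s := V[b₁ ↦ r₁(s)V(b₁), b₂ ↦ r₂(s)V(b₂)]` at `b₁ = ⟨y₀+e₀, e₁⟩`, `b₂ = ⟨y₀+e₀, e₂⟩`: continuity in `s`, `V_0 = V`, and the
  holonomies of `p₁ = (y₀; 0,1)`, `p₂ = (y₀; 0,2)`: `V_s(∂pᵢ) = g·rᵢ(s)·(g⁻¹·V(∂pᵢ))`, `g = V⟨y₀, e₀⟩` (the six other bonds of `∂p₁ ∪ ∂p₂` are neither `b₁` nor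
  `b₂`: five by direction, one because `y₀ + e₀ ≠ y₀`).
* §3 ★★ `mem_closure_irreducible` — every `V : GaugeField P j SU(2)` (`3 ≤ d`) lies in the closure of `{V′ | every V′-parallel section is scalar}`
  (✓`Prop7SU2NonCommutingPairs.exists_nonCommuting_near` at `(g⁻¹V(∂p₁)g, g⁻¹V(∂p₂)g)`, `mem_closure_of_tendsto` along `𝓝[(0,1)] 0`); ★★ `dense_irreducible_T3` —
  the (DENSE) hypothesis of `…ExistenceByDensityLimit` §3 VERBATIM for the members of a `T3Family` (`d = 3`).

HONEST SCOPE.  Elementary; nothing of [Balaban1985Variational] is asserted; no stub ∕ crux statement is advanced; YM₃ on T³ = rung R3 — not d = 4, not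
infinite volume, not a mass gap, not Clay.

References: T. Bałaban, CMP 102 (1985) 277–309 [Balaban1985Variational] (Prop. 7 p.299 — the existence clause this line serves; (3)–(7) p.278 bookkeeping);
CMP 98 (1985) 17–51 [Balaban1985Averaging] ((5), (9) pp.18–19: bonds, plaquette variables).
-/

set_option autoImplicit false

noncomputable section

open Set Filter Topology Complex
open Literature.MathematicalPhysics.QuantumFieldTheory.Balaban1983to89
open Literature.MathematicalPhysics.QuantumFieldTheory.Balaban1983to89.T3ContinuumYM3Torus
open Summit.QuantumFields.YangMills.Theorems.Prop7SU2NonCommutingPairs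
open Summit.QuantumFields.YangMills.BalabanUVNodes.N12FlatFibreNullSpace (const_of_shift_eq)
open B5Positivity172Lattice (TT ofT)

namespace Summit.QuantumFields.YangMills.Theorems.Prop7IrreducibleCoarseFieldsDense

variable {P : Params} {j : ℕ}

/-! ## §1 Parallel sections, plaquette holonomies, scalars -/

/-- Unitarity of a special-unitary bond variable, both orders. [folklore] -/
theorem su_mul_star (g : Matrix.specialUnitaryGroup (Fin 2) ℂ) :
    (g : Matrix (Fin 2) (Fin 2) ℂ) * star (g : Matrix (Fin 2) (Fin 2) ℂ) = 1 ∧ star (g : Matrix (Fin 2) (Fin 2) ℂ) * (g : Matrix (Fin 2) (Fin 2) ℂ) = 1 :=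
  ⟨Matrix.mem_unitaryGroup_iff.mp (Matrix.mem_specialUnitaryGroup_iff.mp g.2).1,
    Matrix.mem_unitaryGroup_iff'.mp (Matrix.mem_specialUnitaryGroup_iff.mp g.2).1⟩

/-- The parallel condition read backwards along a bond: `cf(b₊)·V(b)⋆ = V(b)⋆·cf(b₋)`. [folklore] -/
theorem parallel_star {V : GaugeField P j (Matrix.specialUnitaryGroup (Fin 2) ℂ)} {cf : Site P j → Matrix (Fin 2) (Fin 2) ℂ}
    (hpar : ∀ e : PBond P j, cf e.src * (V e : Matrix (Fin 2) (Fin 2) ℂ) = (V e : Matrix (Fin 2) (Fin 2) ℂ) * cf e.tgt) (e : PBond P j) :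
    cf e.tgt * star (V e : Matrix (Fin 2) (Fin 2) ℂ) = star (V e : Matrix (Fin 2) (Fin 2) ℂ) * cf e.src := by
  obtain ⟨h1, h2⟩ := su_mul_star (V e)
  calc cf e.tgt * star (V e : Matrix (Fin 2) (Fin 2) ℂ)
      = star (V e : Matrix (Fin 2) (Fin 2) ℂ) * ((V e : Matrix (Fin 2) (Fin 2) ℂ) * cf e.tgt) * star (V e : Matrix (Fin 2) (Fin 2) ℂ) := by
        rw [← mul_assoc, h2, one_mul]
    _ = star (V e : Matrix (Fin 2) (Fin 2) ℂ) * (cf e.src * (V e : Matrix (Fin 2) (Fin 2) ℂ)) * star (V e : Matrix (Fin 2) (Fin 2) ℂ) := by rw [hpar e]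
    _ = star (V e : Matrix (Fin 2) (Fin 2) ℂ) * cf e.src := by rw [mul_assoc, mul_assoc, h1, mul_one]

/-- **A PARALLEL SECTION COMMUTES WITH EVERY PLAQUETTE HOLONOMY AT THE BASE SITE**: transport around `∂p` returns `cf(p₋)` conjugated by `V(∂p)`.
[cite: Balaban1985Averaging, (9) p.19 (bookkeeping)] -/
theorem mul_plaqHol_eq_of_parallel (V : GaugeField P j (Matrix.specialUnitaryGroup (Fin 2) ℂ)) (cf : Site P j → Matrix (Fin 2) (Fin 2) ℂ)
    (hpar : ∀ e : PBond P j, cf e.src * (V e : Matrix (Fin 2) (Fin 2) ℂ) = (V e : Matrix (Fin 2) (Fin 2) ℂ) * cf e.tgt) (p : Plaq P j) :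
    cf p.src * ((GaugeField.plaqHol V p : Matrix.specialUnitaryGroup (Fin 2) ℂ) : Matrix (Fin 2) (Fin 2) ℂ) = ((GaugeField.plaqHol V p : Matrix.specialUnitaryGroup (Fin 2) ℂ) : Matrix (Fin 2) (Fin 2) ℂ) * cf p.src := by
  -- the four bonds of `∂p` and the commuting translations
  have hcomm : (p.src.shift p.μ).shift p.ν = (p.src.shift p.ν).shift p.μ := by
    funext κ
    by_cases h1 : κ = p.ν
    · subst h1
      by_cases h2 : p.ν = p.μ
      · rw [h2]
      · simp [Site.shift, Function.update_self, Function.update_of_ne h2]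
    · by_cases h2 : κ = p.μ
      · subst h2
        simp [Site.shift, Function.update_self, Function.update_of_ne h1]
      · simp [Site.shift, Function.update_of_ne h1, Function.update_of_ne h2]
  have e1 := hpar ⟨p.src, p.μ⟩
  have e2 := hpar ⟨p.src.shift p.μ, p.ν⟩
  have e3 := parallel_star hpar ⟨p.src.shift p.ν, p.μ⟩
  have e4 := parallel_star hpar ⟨p.src, p.ν⟩
  simp only [PBond.tgt] at e1 e2 e3 e4
  rw [← hcomm] at e3
  simp only [GaugeField.plaqHol, Submonoid.coe_mul, Literature.MathematicalPhysics.QuantumLattice.coe_inv_eq_star]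
  -- move `cf` through the four factors
  calc cf p.src * ((V ⟨p.src, p.μ⟩ : Matrix (Fin 2) (Fin 2) ℂ) * (V ⟨p.src.shift p.μ, p.ν⟩ : Matrix (Fin 2) (Fin 2) ℂ) *
        star (V ⟨p.src.shift p.ν, p.μ⟩ : Matrix (Fin 2) (Fin 2) ℂ) * star (V ⟨p.src, p.ν⟩ : Matrix (Fin 2) (Fin 2) ℂ))
      = (cf p.src * (V ⟨p.src, p.μ⟩ : Matrix (Fin 2) (Fin 2) ℂ)) * (V ⟨p.src.shift p.μ, p.ν⟩ : Matrix (Fin 2) (Fin 2) ℂ) *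
        star (V ⟨p.src.shift p.ν, p.μ⟩ : Matrix (Fin 2) (Fin 2) ℂ) * star (V ⟨p.src, p.ν⟩ : Matrix (Fin 2) (Fin 2) ℂ) := by noncomm_ring
    _ = (V ⟨p.src, p.μ⟩ : Matrix (Fin 2) (Fin 2) ℂ) * (cf (p.src.shift p.μ) * (V ⟨p.src.shift p.μ, p.ν⟩ : Matrix (Fin 2) (Fin 2) ℂ)) *
        star (V ⟨p.src.shift p.ν, p.μ⟩ : Matrix (Fin 2) (Fin 2) ℂ) * star (V ⟨p.src, p.ν⟩ : Matrix (Fin 2) (Fin 2) ℂ) := by rw [e1]; noncomm_ring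
    _ = (V ⟨p.src, p.μ⟩ : Matrix (Fin 2) (Fin 2) ℂ) * (V ⟨p.src.shift p.μ, p.ν⟩ : Matrix (Fin 2) (Fin 2) ℂ) *
        (cf ((p.src.shift p.μ).shift p.ν) * star (V ⟨p.src.shift p.ν, p.μ⟩ : Matrix (Fin 2) (Fin 2) ℂ)) * star (V ⟨p.src, p.ν⟩ : Matrix (Fin 2) (Fin 2) ℂ) := by
        rw [e2]; noncomm_ring
    _ = (V ⟨p.src, p.μ⟩ : Matrix (Fin 2) (Fin 2) ℂ) * (V ⟨p.src.shift p.μ, p.ν⟩ : Matrix (Fin 2) (Fin 2) ℂ) *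
        star (V ⟨p.src.shift p.ν, p.μ⟩ : Matrix (Fin 2) (Fin 2) ℂ) * (cf (p.src.shift p.ν) * star (V ⟨p.src, p.ν⟩ : Matrix (Fin 2) (Fin 2) ℂ)) := by
        rw [e3]; noncomm_ring
    _ = (V ⟨p.src, p.μ⟩ : Matrix (Fin 2) (Fin 2) ℂ) * (V ⟨p.src.shift p.μ, p.ν⟩ : Matrix (Fin 2) (Fin 2) ℂ) *
        star (V ⟨p.src.shift p.ν, p.μ⟩ : Matrix (Fin 2) (Fin 2) ℂ) * star (V ⟨p.src, p.ν⟩ : Matrix (Fin 2) (Fin 2) ℂ) * cf p.src := by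
        rw [e4]; noncomm_ring

/-- Along a bond, `cf(b₊) = z·1 ↔ cf(b₋) = z·1` for a parallel section. [folklore] -/
theorem parallel_shift_iff {V : GaugeField P j (Matrix.specialUnitaryGroup (Fin 2) ℂ)} {cf : Site P j → Matrix (Fin 2) (Fin 2) ℂ}
    (hpar : ∀ e : PBond P j, cf e.src * (V e : Matrix (Fin 2) (Fin 2) ℂ) = (V e : Matrix (Fin 2) (Fin 2) ℂ) * cf e.tgt) (z : ℂ) (x : Site P j) (μ : Fin P.d) :
    cf (x.shift μ) = z • (1 : Matrix (Fin 2) (Fin 2) ℂ) ↔ cf x = z • (1 : Matrix (Fin 2) (Fin 2) ℂ) := by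
  obtain ⟨h1, h2⟩ := su_mul_star (V ⟨x, μ⟩)
  have e := hpar ⟨x, μ⟩
  simp only [PBond.tgt] at e
  constructor
  · intro h
    rw [h, mul_smul_comm, mul_one] at e
    calc cf x = cf x * (V ⟨x, μ⟩ : Matrix (Fin 2) (Fin 2) ℂ) * star (V ⟨x, μ⟩ : Matrix (Fin 2) (Fin 2) ℂ) := by rw [mul_assoc, h1, mul_one]
      _ = z • (1 : Matrix (Fin 2) (Fin 2) ℂ) := by rw [e, smul_mul_assoc, h1]
  · intro h
    rw [h, smul_mul_assoc, one_mul] at e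
    calc cf (x.shift μ) = star (V ⟨x, μ⟩ : Matrix (Fin 2) (Fin 2) ℂ) * ((V ⟨x, μ⟩ : Matrix (Fin 2) (Fin 2) ℂ) * cf (x.shift μ)) := by
          rw [← mul_assoc, h2, one_mul]
      _ = z • (1 : Matrix (Fin 2) (Fin 2) ℂ) := by rw [← e, mul_smul_comm, h2]

/-- ★ **NON-COMMUTING PLAQUETTE HOLONOMIES AT ONE SITE ⇒ EVERY PARALLEL SECTION IS A SCALAR CONSTANT.** [cite: Balaban1985Averaging, (9) p.19 (bookkeeping)] -/
theorem forall_eq_smul_one_of_parallel (V : GaugeField P j (Matrix.specialUnitaryGroup (Fin 2) ℂ)) {p₁ p₂ : Plaq P j} (hsrc : p₂.src = p₁.src)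
    (hne : ((GaugeField.plaqHol V p₁ : Matrix.specialUnitaryGroup (Fin 2) ℂ) : Matrix (Fin 2) (Fin 2) ℂ) * ((GaugeField.plaqHol V p₂ : Matrix.specialUnitaryGroup (Fin 2) ℂ) : Matrix (Fin 2) (Fin 2) ℂ) ≠
      ((GaugeField.plaqHol V p₂ : Matrix.specialUnitaryGroup (Fin 2) ℂ) : Matrix (Fin 2) (Fin 2) ℂ) * ((GaugeField.plaqHol V p₁ : Matrix.specialUnitaryGroup (Fin 2) ℂ) : Matrix (Fin 2) (Fin 2) ℂ))
    (cf : Site P j → Matrix (Fin 2) (Fin 2) ℂ)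
    (hpar : ∀ e : PBond P j, cf e.src * (V e : Matrix (Fin 2) (Fin 2) ℂ) = (V e : Matrix (Fin 2) (Fin 2) ℂ) * cf e.tgt) :
    ∃ z : ℂ, ∀ y : Site P j, cf y = z • (1 : Matrix (Fin 2) (Fin 2) ℂ) := by
  classical
  have c1 := mul_plaqHol_eq_of_parallel V cf hpar p₁
  have c2 := mul_plaqHol_eq_of_parallel V cf hpar p₂
  rw [hsrc] at c2
  obtain ⟨z, hz⟩ := exists_eq_smul_one_of_commute_of_not_commute c1 c2 hne
  refine ⟨z, fun y => ?_⟩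
  -- the indicator of `{cf = z·1}` is shift-invariant, hence constant, hence `1` everywhere
  set ψ : Site P j → ℤ := fun x => if cf x = z • (1 : Matrix (Fin 2) (Fin 2) ℂ) then 1 else 0 with hψ
  have hshift : ∀ (x : Site P j) (μ : Fin P.d), ψ (x.shift μ) = ψ x := by
    intro x μ
    simp only [hψ, parallel_shift_iff hpar z x μ]
  have hy := const_of_shift_eq ψ hshift y
  have h0 := const_of_shift_eq ψ hshift p₁.src
  have h1 : ψ p₁.src = 1 := by simp only [hψ, hz, if_true]
  rw [← hy, h1] at h0
  -- so `ψ y = 1`, i.e. `cf y = z·1`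
  by_contra hne'
  have : ψ y = 0 := by simp only [hψ, hne', if_false]
  rw [this] at h0
  exact one_ne_zero h0

/-! ## §2 The two-bond perturbation and its two plaquette holonomies -/

section Perturb

variable (V : GaugeField P j (Matrix.specialUnitaryGroup (Fin 2) ℂ)) (y₀ : Site P j) {μ0 μ1 μ2 : Fin P.d}

/-- `y₀ + e_μ ≠ y₀` on the torus (`1 ≠ 0` in `ZMod (sitesPerDir j)`). [folklore] -/
theorem shift_ne_self (μ : Fin P.d) : y₀.shift μ ≠ y₀ := by
  intro h
  have h1 := congrFun h μ
  simp only [Site.shift, Function.update_self] at h1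
  exact one_ne_zero (add_eq_left.1 h1)

/-- The perturbed field `V[b₁ ↦ c₁V(b₁), b₂ ↦ c₂V(b₂)]` evaluated at the bonds of `∂p₁`, `∂p₂` (`p₁ = (y₀; μ0, μ1)`, `p₂ = (y₀; μ0, μ2)`,
`b₁ = ⟨y₀+e_{μ0}, μ1⟩`, `b₂ = ⟨y₀+e_{μ0}, μ2⟩`, all three directions distinct): the two holonomies pick up exactly one factor each.
[cite: Balaban1985Averaging, (9) p.19 (bookkeeping)] -/
theorem plaqHol_update₂ [DecidableEq (PBond P j)] (h01 : μ0 ≠ μ1) (h02 : μ0 ≠ μ2) (h12 : μ1 ≠ μ2) (hμ01 : μ0 < μ1) (hμ02 : μ0 < μ2)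
    (c₁ c₂ : Matrix.specialUnitaryGroup (Fin 2) ℂ) :
    GaugeField.plaqHol (Function.update (Function.update V ⟨y₀.shift μ0, μ1⟩ (c₁ * V ⟨y₀.shift μ0, μ1⟩)) ⟨y₀.shift μ0, μ2⟩ (c₂ * V ⟨y₀.shift μ0, μ2⟩))
        ⟨y₀, μ0, μ1, hμ01⟩ = V ⟨y₀, μ0⟩ * c₁ * ((V ⟨y₀, μ0⟩)⁻¹ * GaugeField.plaqHol V ⟨y₀, μ0, μ1, hμ01⟩) ∧
    GaugeField.plaqHol (Function.update (Function.update V ⟨y₀.shift μ0, μ1⟩ (c₁ * V ⟨y₀.shift μ0, μ1⟩)) ⟨y₀.shift μ0, μ2⟩ (c₂ * V ⟨y₀.shift μ0, μ2⟩))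
        ⟨y₀, μ0, μ2, hμ02⟩ = V ⟨y₀, μ0⟩ * c₂ * ((V ⟨y₀, μ0⟩)⁻¹ * GaugeField.plaqHol V ⟨y₀, μ0, μ2, hμ02⟩) := by
  have hs := shift_ne_self y₀ μ0
  -- bond (in)equalities
  have n1 : (⟨y₀, μ0⟩ : PBond P j) ≠ ⟨y₀.shift μ0, μ2⟩ := fun h => h02 (congrArg PBond.dir h)
  have n2 : (⟨y₀, μ0⟩ : PBond P j) ≠ ⟨y₀.shift μ0, μ1⟩ := fun h => h01 (congrArg PBond.dir h)
  have n3 : (⟨y₀.shift μ0, μ1⟩ : PBond P j) ≠ ⟨y₀.shift μ0, μ2⟩ := fun h => h12 (congrArg PBond.dir h)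
  have n4 : (⟨y₀.shift μ1, μ0⟩ : PBond P j) ≠ ⟨y₀.shift μ0, μ2⟩ := fun h => h02 (congrArg PBond.dir h)
  have n5 : (⟨y₀.shift μ1, μ0⟩ : PBond P j) ≠ ⟨y₀.shift μ0, μ1⟩ := fun h => h01 (congrArg PBond.dir h)
  have n6 : (⟨y₀, μ1⟩ : PBond P j) ≠ ⟨y₀.shift μ0, μ2⟩ := fun h => h12 (congrArg PBond.dir h)
  have n7 : (⟨y₀, μ1⟩ : PBond P j) ≠ ⟨y₀.shift μ0, μ1⟩ := fun h => hs (congrArg PBond.src h).symm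
  have n8 : (⟨y₀.shift μ2, μ0⟩ : PBond P j) ≠ ⟨y₀.shift μ0, μ2⟩ := fun h => h02 (congrArg PBond.dir h)
  have n9 : (⟨y₀.shift μ2, μ0⟩ : PBond P j) ≠ ⟨y₀.shift μ0, μ1⟩ := fun h => h01 (congrArg PBond.dir h)
  have n10 : (⟨y₀, μ2⟩ : PBond P j) ≠ ⟨y₀.shift μ0, μ2⟩ := fun h => hs (congrArg PBond.src h).symm
  have n11 : (⟨y₀, μ2⟩ : PBond P j) ≠ ⟨y₀.shift μ0, μ1⟩ := fun h => h12.symm (congrArg PBond.dir h)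
  constructor
  · simp only [GaugeField.plaqHol, Function.update_of_ne n1, Function.update_of_ne n2, Function.update_of_ne n3, Function.update_self,
      Function.update_of_ne n4, Function.update_of_ne n5, Function.update_of_ne n6, Function.update_of_ne n7]
    group
  · simp only [GaugeField.plaqHol, Function.update_of_ne n1, Function.update_of_ne n2, Function.update_self,
      Function.update_of_ne n8, Function.update_of_ne n9, Function.update_of_ne n10, Function.update_of_ne n11]
    group

end Perturb

/-! ## §3 ★★ Density -/

/-- ★★ **IRREDUCIBLE FIELDS ARE DENSE**: every `SU(2)` gauge field on `T^{(j)}` (`3 ≤ d`) lies in the closure of the set of fields all of whose parallel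
`M₂(ℂ)`-sections are scalar constants. [cite: Balaban1985Variational, (3)-(7) p.278 (bookkeeping)] -/
theorem mem_closure_irreducible (hd : 2 < P.d) (V : GaugeField P j (Matrix.specialUnitaryGroup (Fin 2) ℂ)) :
    V ∈ closure {V' : GaugeField P j (Matrix.specialUnitaryGroup (Fin 2) ℂ) |
      ∀ cf : Site P j → Matrix (Fin 2) (Fin 2) ℂ,
        (∀ e : PBond P j, cf e.src * (V' e : Matrix (Fin 2) (Fin 2) ℂ) = (V' e : Matrix (Fin 2) (Fin 2) ℂ) * cf e.tgt) →
        ∃ z : ℂ, ∀ y : Site P j, cf y = z • (1 : Matrix (Fin 2) (Fin 2) ℂ)} := by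
  classical
  -- three distinct directions and a base site
  set μ0 : Fin P.d := ⟨0, by omega⟩ with hμ0
  set μ1 : Fin P.d := ⟨1, by omega⟩ with hμ1
  set μ2 : Fin P.d := ⟨2, hd⟩ with hμ2
  have h01 : μ0 ≠ μ1 := by simp [hμ0, hμ1, Fin.ext_iff]
  have h02 : μ0 ≠ μ2 := by simp [hμ0, hμ2, Fin.ext_iff]
  have h12 : μ1 ≠ μ2 := by simp [hμ1, hμ2, Fin.ext_iff]
  have hμ01 : μ0 < μ1 := by simp [hμ0, hμ1, Fin.lt_def]
  have hμ02 : μ0 < μ2 := by simp [hμ0, hμ2, Fin.lt_def]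
  set y₀ : Site P j := default with hy₀
  set g : Matrix.specialUnitaryGroup (Fin 2) ℂ := V ⟨y₀, μ0⟩ with hg
  set k₁ : Matrix.specialUnitaryGroup (Fin 2) ℂ := g⁻¹ * GaugeField.plaqHol V ⟨y₀, μ0, μ1, hμ01⟩ with hk₁
  set k₂ : Matrix.specialUnitaryGroup (Fin 2) ℂ := g⁻¹ * GaugeField.plaqHol V ⟨y₀, μ0, μ2, hμ02⟩ with hk₂
  -- the non-commuting perturbation of the pair `(k₁ g, k₂ g)`
  obtain ⟨r₁, r₂, hr₁, hr₂, hr₁0, hr₂0, hnc⟩ := exists_nonCommuting_near (k₁ * g) (k₂ * g)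
  -- the perturbed fields
  set W : ℝ → GaugeField P j (Matrix.specialUnitaryGroup (Fin 2) ℂ) := fun s =>
    Function.update (Function.update V ⟨y₀.shift μ0, μ1⟩ (r₁ s * V ⟨y₀.shift μ0, μ1⟩)) ⟨y₀.shift μ0, μ2⟩ (r₂ s * V ⟨y₀.shift μ0, μ2⟩) with hW
  -- continuity and the value at `s = 0`
  have hWc : Continuous W := by
    refine continuous_pi fun b => ?_
    simp only [hW, Function.update_apply]
    split_ifs
    · exact hr₂.mul continuous_const
    · exact hr₁.mul continuous_const
    · exact continuous_const
  have hW0 : W 0 = V := by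
    simp only [hW, hr₁0, hr₂0, one_mul, Function.update_eq_self]
  -- irreducibility of `W s`, `s ∈ (0, 1)`
  have hirr : ∀ s : ℝ, 0 < s → s < 1 → W s ∈ {V' : GaugeField P j (Matrix.specialUnitaryGroup (Fin 2) ℂ) |
      ∀ cf : Site P j → Matrix (Fin 2) (Fin 2) ℂ,
        (∀ e : PBond P j, cf e.src * (V' e : Matrix (Fin 2) (Fin 2) ℂ) = (V' e : Matrix (Fin 2) (Fin 2) ℂ) * cf e.tgt) →
        ∃ z : ℂ, ∀ y : Site P j, cf y = z • (1 : Matrix (Fin 2) (Fin 2) ℂ)} := by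
    intro s hs0 hs1 cf hpar
    obtain ⟨hp₁, hp₂⟩ := plaqHol_update₂ V y₀ h01 h02 h12 hμ01 hμ02 (r₁ s) (r₂ s)
    refine forall_eq_smul_one_of_parallel (W s) (p₁ := ⟨y₀, μ0, μ1, hμ01⟩) (p₂ := ⟨y₀, μ0, μ2, hμ02⟩) rfl ?_ cf hpar
    -- `W_s(∂p₁) = g·r₁·k₁`, `W_s(∂p₂) = g·r₂·k₂`; their non-commutation is that of `(r₁·(k₁g), r₂·(k₂g))` conjugated by `g`
    have e1 : GaugeField.plaqHol (W s) ⟨y₀, μ0, μ1, hμ01⟩ = g * r₁ s * k₁ := hp₁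
    have e2 : GaugeField.plaqHol (W s) ⟨y₀, μ0, μ2, hμ02⟩ = g * r₂ s * k₂ := hp₂
    intro habs
    apply hnc s hs0 hs1
    -- rewrite everything in the group `SU(2)` first
    have hgrp : g * r₁ s * k₁ * (g * r₂ s * k₂) = g * r₂ s * k₂ * (g * r₁ s * k₁) := by
      rw [← e1, ← e2]
      exact Subtype.ext (by rw [Submonoid.coe_mul, Submonoid.coe_mul]; exact habs)
    have hgrp' : r₁ s * (k₁ * g) * (r₂ s * (k₂ * g)) = r₂ s * (k₂ * g) * (r₁ s * (k₁ * g)) := by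
      have hconj : g⁻¹ * (g * r₁ s * k₁ * (g * r₂ s * k₂)) * g = g⁻¹ * (g * r₂ s * k₂ * (g * r₁ s * k₁)) * g := by rw [hgrp]
      calc r₁ s * (k₁ * g) * (r₂ s * (k₂ * g)) = g⁻¹ * (g * r₁ s * k₁ * (g * r₂ s * k₂)) * g := by group
        _ = g⁻¹ * (g * r₂ s * k₂ * (g * r₁ s * k₁)) * g := hconj
        _ = r₂ s * (k₂ * g) * (r₁ s * (k₁ * g)) := by group
    have := congrArg (fun x : Matrix.specialUnitaryGroup (Fin 2) ℂ => (x : Matrix (Fin 2) (Fin 2) ℂ)) hgrp'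
    simpa only [Submonoid.coe_mul] using this
  -- the limit `s → 0⁺`
  haveI : (𝓝[Ioo (0 : ℝ) 1] (0 : ℝ)).NeBot := by
    apply mem_closure_iff_nhdsWithin_neBot.mp
    rw [closure_Ioo zero_ne_one]
    exact ⟨le_rfl, zero_le_one⟩
  have htend : Tendsto W (𝓝[Ioo (0 : ℝ) 1] 0) (𝓝 V) := by
    rw [← hW0]
    exact (hWc.tendsto 0).mono_left nhdsWithin_le_nhds
  refine mem_closure_of_tendsto htend ?_
  filter_upwards [self_mem_nhdsWithin] with s hs
  exact hirr s hs.1 hs.2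

/-- ★★ **(DENSE) FOR THE T³ MEMBERS** — the hypothesis `hdense` of ✓-candidate `Prop7ExistenceByDensityLimit.existenceMinimalOrbit_of_macroSector_dense_localSurj`
VERBATIM, with the sector `Sec F n V := «every V-parallel M₂(ℂ)-section is scalar»` (`d = 3` on every lattice of a `T3Family`).
[cite: Balaban1985Variational, (7) p.278, Prop. 7 p.299 (bookkeeping)] -/
theorem dense_irreducible_T3 (L : ℕ) :
    ∀ (F : T3Family), F.L = L → ∀ (n : ℕ) (V : GaugeField (F.P n) 0 (Matrix.specialUnitaryGroup (Fin 2) ℂ)),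
      V ∈ closure {V' : GaugeField (F.P n) 0 (Matrix.specialUnitaryGroup (Fin 2) ℂ) |
        ∀ cf : Site (F.P n) 0 → Matrix (Fin 2) (Fin 2) ℂ,
          (∀ e : PBond (F.P n) 0, cf e.src * (V' e : Matrix (Fin 2) (Fin 2) ℂ) = (V' e : Matrix (Fin 2) (Fin 2) ℂ) * cf e.tgt) →
          ∃ z : ℂ, ∀ y : Site (F.P n) 0, cf y = z • (1 : Matrix (Fin 2) (Fin 2) ℂ)} :=
  fun F _ n V => mem_closure_irreducible (by rw [T3Family.P_d]; norm_num) V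

end Summit.QuantumFields.YangMills.Theorems.Prop7IrreducibleCoarseFieldsDense

end
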